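import Mathlib
import Summits.Ventures.HodgeRepro.Tier4.Common.MixedPlaneCusp
import Summits.Ventures.HodgeRepro.Tier4.LitCompactnessPlane
import Summits.Ventures.HodgeRepro.Tier4.Line1.QuotientCompact
import Summits.Ventures.HodgeRepro.Tier4.Line1.RealisedSetting
import Summits.Ventures.HodgeRepro.Tier4.Line1.DefinedContentOfData

/-!
# Tier4/Line1/RealisedSettingAniso — C-L4-ANISO-SETTING (a): L1's adelic setting on an ANISOTROPIC genuine plane,
CONDITIONAL on the typed print `Lit.BorelHarishChandra1962_Thm11_8_cocompact_plane_aniso` (lit-3 p696518)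

Blind re-derivation cell `pub-hodge-repro`, Tier 4 (README §9–§10), seat t4-L1-p5 (prover, gen 4).  The cut (a) of
C-L4-ANISO-SETTING as plan-4 g3 priced it on lit-3's print (S14663: «ONE LINE … and `Setting.ofAdelicAniso` follows by
name»), named for «the first of the two idle at a module boundary» by lead g386 (S14693).  Target tree path
`lean/Summits/Ventures/HodgeRepro/Tier4/Line1/RealisedSettingAniso.lean`.

WHAT IS HERE.  Every theorem takes the print as the DISPLAYED hypothesis
`hp : Lit.BorelHarishChandra1962_Thm11_8_cocompact_plane_aniso W` («for a genuine `k`-anisotropic hermitian plane,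
`U(h)(𝔸_k) = U(h)(k) · C` with `C` compact», Borel 1963 Thm 5.6 (ii) / Borel–Harish-Chandra 1962 Thm 11.8 / Godement,
as typed by t4-lit-3) — so everything below is CONDITIONAL on that print; nothing of it is proved here.
* `cocompact_rationalPoints_aniso` — the print instantiated: the conclusion is byte-for-byte L1's definite theorem
  `cocompact_rationalPoints` (QuotientCompact).
* `quotient_compact_genuine_aniso` / `haar_rightInvariant_genuine_aniso` — (I1-c) / (I1-d) on an anisotropic plane
  through L1's own reductions (`quotient_compact_of_cocompact`, `haar_rightInvariant_of_quotient_compact'`): the SAME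
  existential statement as `quotient_compact_genuine`.
* `Setting.ofAdelicAniso` — `Setting.ofAdelicData` on the chosen compact fundamental domain, exactly as
  `Setting.ofAdelic` (RealisedSetting), with `hW : IsDefinite W` replaced by `hp` + `hA : IsAnisotropic W`; the
  bridges `kernel_ofAdelicAniso`, `R_ofAdelicAniso` (`rfl`), `isCharacter_ofAdelicAniso`, `isCharacter'_ofAdelicAniso`,
  `centralMatch_ofAdelicAniso`, and the discrete spectrum `exists_adaptedONB_aniso` (p3's `exists_adaptedONB_ofData`,
  generic in the domain).
* THE COSTUME TEST `ofAdelicAniso_eq_ofAdelic` (`rfl`): on a plane that is DEFINITE at some real place (hence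
  anisotropic, lit-3's glue `Lit.isAnisotropic_of_isDefinite`) the anisotropic setting IS `Setting.ofAdelic` —
  definitionally, because the two compactness theorems prove the SAME proposition and `Classical.choose` of
  proof-irrelevant proofs agrees.

WHAT IS NOT HERE (the deferred (β), plan-4 S14640/S14663): the J2 content on the anisotropic setting
(`orbitOf_eq_of_conj`, `exists_isolating_nbhd`, `exists_isolating_tests`, … take `hW` through RationalConj's
`form_self_ne_zero`) and the ≈ 130 by-name consumers of `Setting.ofAdelic W hW hg …`; and the PRINT-FREE twin of the
R-c chain (S14619 (α): mechanical — `IsDefinite` enters the chain only through anisotropy and `det B ≠ 0`), which would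
discharge `hp`.  Nothing here says anything about the status of the Hodge conjecture for CM abelian varieties, which is
NOT proved (HC_CM is NOT proved by anyone in this repository).
-/

set_option autoImplicit false

noncomputable section

namespace Summit.Ventures.HodgeRepro.Tier4.Line1

open NumberField Common MeasureTheory Topology

section Aniso

variable {k : Type} [Field k] [NumberField k] (W : PlaneData k)

/-- **R-c on an anisotropic genuine plane, CONDITIONAL on the typed print** (lit-3 p696518): the rational points are
cocompact in the adelic points — the conclusion of `cocompact_rationalPoints`, with `IsDefinite` replaced by
`IsAnisotropic`. -/
theorem cocompact_rationalPoints_aniso (hp : Lit.BorelHarishChandra1962_Thm11_8_cocompact_plane_aniso W)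
    (hg : IsGenuineRow W) (hA : IsAnisotropic W) :
    ∃ C : Set (GA W), IsCompact C ∧ ∀ g : GA W, ∃ γ : rationalPoints W, ∃ c ∈ C, g = (γ : GA W) * c :=
  hp hg hA

/-- **(I1-c) on an anisotropic genuine plane, CONDITIONAL on the print**: `[U(W)]` is compact — for every Haar measure a
fundamental domain of the rational points with compact closure exists (the SAME statement as
`quotient_compact_genuine`, through L1's reduction `quotient_compact_of_cocompact`). -/
theorem quotient_compact_genuine_aniso (hp : Lit.BorelHarishChandra1962_Thm11_8_cocompact_plane_aniso W)
    (hg : IsGenuineRow W) (hA : IsAnisotropic W) [MeasurableSpace (GA W)] [BorelSpace (GA W)]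
    (μ : Measure (GA W)) [μ.IsHaarMeasure] :
    ∃ D : Set (GA W), IsFundamentalDomain (rationalPoints W) D μ ∧ IsCompact (closure D) :=
  quotient_compact_of_cocompact W μ (cocompact_rationalPoints_aniso W hp hg hA)

/-- **(I1-d) on an anisotropic genuine plane, CONDITIONAL on the print**: `U(W)(𝔸_k)` is unimodular. -/
theorem haar_rightInvariant_genuine_aniso (hp : Lit.BorelHarishChandra1962_Thm11_8_cocompact_plane_aniso W)
    (hg : IsGenuineRow W) (hA : IsAnisotropic W) [MeasurableSpace (GA W)] [BorelSpace (GA W)]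
    (μ : Measure (GA W)) [μ.IsHaarMeasure] : μ.IsMulRightInvariant :=
  haar_rightInvariant_of_quotient_compact' W μ (quotient_compact_genuine_aniso W hp hg hA μ)

variable [MeasurableSpace (GA W)] [BorelSpace (GA W)]

/-- **The generic setting of Line 1 on the defined adelic objects of an ANISOTROPIC genuine plane**, CONDITIONAL on the
print: `Setting.ofAdelicData` on the compact fundamental domain of `quotient_compact_genuine_aniso` — exactly
`Setting.ofAdelic` with `hW : IsDefinite W` replaced by `hp` + `hA : IsAnisotropic W`. -/
def Setting.ofAdelicAniso (hp : Lit.BorelHarishChandra1962_Thm11_8_cocompact_plane_aniso W) (hg : IsGenuineRow W)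
    (hA : IsAnisotropic W) (R : RTFData W) (μ : Measure (GA W)) [μ.IsHaarMeasure] [R.μT.IsHaarMeasure]
    [R.μT'.IsHaarMeasure] (hT : IsCompact (closure R.DT)) (hT' : IsCompact (closure R.DT')) : RTF.Setting (GA W) :=
  Setting.ofAdelicData W R μ (Classical.choose (quotient_compact_genuine_aniso W hp hg hA μ))
    (Classical.choose_spec (quotient_compact_genuine_aniso W hp hg hA μ)).1
    (Classical.choose_spec (quotient_compact_genuine_aniso W hp hg hA μ)).2 hT hT'

variable (hp : Lit.BorelHarishChandra1962_Thm11_8_cocompact_plane_aniso W) (hg : IsGenuineRow W)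
  (hA : IsAnisotropic W) (R : RTFData W) (μ : Measure (GA W)) [μ.IsHaarMeasure] [R.μT.IsHaarMeasure]
  [R.μT'.IsHaarMeasure] (hT : IsCompact (closure R.DT)) (hT' : IsCompact (closure R.DT'))

/-- **THE COSTUME TEST** (`rfl`): on a plane definite at some real place — hence anisotropic, lit-3's glue
`Lit.isAnisotropic_of_isDefinite` — the anisotropic setting IS L1's `Setting.ofAdelic`: both are `Setting.ofAdelicData`
on `Classical.choose` of a proof of the SAME proposition (`quotient_compact_genuine` / `quotient_compact_genuine_aniso`),
and proofs are definitionally irrelevant. -/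
theorem ofAdelicAniso_eq_ofAdelic (hW : IsDefinite W) :
    Setting.ofAdelicAniso W hp hg (Lit.isAnisotropic_of_isDefinite W hW) R μ hT hT' =
      Setting.ofAdelic W hW hg R μ hT hT' :=
  rfl

/-- bridge (`rfl`): the generic kernel on the anisotropic instance IS typer-2's `kernel`. -/
theorem kernel_ofAdelicAniso (f : GA W → ℂ) (x y : GA W) :
    (Setting.ofAdelicAniso W hp hg hA R μ hT hT').kernel f x y = Common.kernel W f x y := rfl

/-- bridge (`rfl`): the generic right regular action on the anisotropic instance IS typer-2's `rightRegular`. -/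
theorem R_ofAdelicAniso (f φ : GA W → ℂ) (x : GA W) :
    (Setting.ofAdelicAniso W hp hg hA R μ hT hT').R f φ x = Common.rightRegular W μ f φ x := rfl

/-- bridge: the character `chi` of the `RTFData`, continuous and unitary, is an `IsCharacter` of the anisotropic
instance. -/
theorem isCharacter_ofAdelicAniso (hc : Continuous R.chi) (hu : ∀ a, ‖R.chi a‖ = 1) :
    (Setting.ofAdelicAniso W hp hg hA R μ hT hT').IsCharacter R.chi :=
  ⟨hc, R.chi_mul, hu, fun a ha => R.chi_rational a (Subgroup.mem_subgroupOf.mp ha)⟩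

/-- bridge: the same for `chi'`. -/
theorem isCharacter'_ofAdelicAniso (hc : Continuous R.chi') (hu : ∀ a, ‖R.chi' a‖ = 1) :
    (Setting.ofAdelicAniso W hp hg hA R μ hT hT').IsCharacter' R.chi' :=
  ⟨hc, R.chi'_mul, hu, fun a ha => R.chi'_rational a (Subgroup.mem_subgroupOf.mp ha)⟩

/-- bridge: N2 of the `RTFData` IS `CentralMatch` on the anisotropic instance. -/
theorem centralMatch_ofAdelicAniso : (Setting.ofAdelicAniso W hp hg hA R μ hT hT').CentralMatch R.chi R.chi' :=
  R.chi_centre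

/-- **the discrete spectrum of the compact quotient on an anisotropic plane**, CONDITIONAL on the print: an adapted
orthonormal family along irreducible invariant subspaces exists (p3's `exists_adaptedONB_ofData`, generic in the
compact fundamental domain). -/
theorem exists_adaptedONB_aniso :
    ∃ (τ : ℕ → Set (GA W → ℂ)) (φ : ℕ → GA W → ℂ) (n : ℕ → ℕ),
      (Setting.ofAdelicAniso W hp hg hA R μ hT hT').IsAdaptedONB τ φ n :=
  exists_adaptedONB_ofData W R μ _ _ _ hT hT'

end Aniso

end Summit.Ventures.HodgeRepro.Tier4.Line1

end
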